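import Summits.ResolutionOfSingularities.ResolutionOfSingularities.Theorems.MarkedTransferCampaignW46WWalkNDPrelim
import Mathlib.RingTheory.MvPowerSeries.Substitution
import Literature.RingTheory.MvPowerSeries.MaximalIdealPow
import HarnessLib

/-!
# [OURS · L1 W4.6 rung (iii-2)] THE W-WALK: (ND) — the degree-`d` form of the inherited residual is NOT divisible by `Z`,
# read from o1's binary presentation of the same germ (LEMMA D of the plan)

Cell `res-hironaka`, LADDER-RESOLUTION rung L (D-0089), slot W4.6 rung (iii); seat res-L1-s46-pv-5 (gen 6), plan
`HOME/L/res-L1-s46-pv-5/W-WALK-PLAN.md` §1 (LEMMA D). Host route MarkedTransfer, `--supports stmt-ResolutionOfSingularities-16155 --as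
helper`; kind proof (def-free).

WHAT (in `K⟦t,y,z⟧`, characteristic `p`). Two presentations of one germ: the INHERITED one `z^p + f` (`ord f ≥ p + 1`) of the walk, and
o1's BINARY one `u · (z₂^p + f₂)`, `f₂ = Σ_{i ≤ d₂} a_i x₂^{d₂−i} y₂^i`, some `a_i` a unit, `p + 1 ≤ d₂ ≤ 2p − 1`, `u` a unit, with
`t, y, z ∈ (x₂, y₂, z₂)` (the regime's `span {x₂, y₂, z₂} = 𝔪`, read in the completion). THEN (`ndz_of_presentation`):
* every monomial `t^a y^b z^c` of `f` of degree `< d₂` with `c < p` has coefficient `0` (so `ord f ≤ d₂`, and `ord f = d₂` as soon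
  as the top form of `f` has a monomial of `z`-degree `< p`, i.e. whenever the shade is `< p`);
* some `z`-FREE monomial of degree `d₂` occurs in `f`: **(ND)** `NDz d₂ f`.
Mechanism: comparing `t^p, y^p, z^p` gives `lin(z₂) = αZ` (`…Compare.coeff_mul_pow_p`), whence `u·z₂^p` has no monomial of degree
`< 2p` with `z`-exponent `< p` other than through `Z^p`; so those coefficients of `f` are the ones of `u·f₂ ≡ u(0)·Σ a_i(0)
L_x^{d₂−i} L_y^i (mod 𝔪^{d₂+1})`, and the `z`-free part of this binary form in the independent linear forms `L_x|_{Z=0}, L_y|_{Z=0}`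
is nonzero (inverse linear substitution).

HONEST FRAMING. OURS; nothing here is a statement of H. Hironaka's manuscript [Hironaka2017] and nothing of it is used. AI-written;
AI review is weaker than expert review. No `sorry`; axioms standard. [folklore]; [Hauser2010] §F for the role of the tangent cone.
-/

noncomputable section

set_option linter.dupNamespace false -- mandated namespace of this single-conjunct summit

open MvPowerSeries Finset IsLocalRing
open Literature.RingTheory.MvPowerSeries.Jets

namespace Summit.ResolutionOfSingularities.ResolutionOfSingularities.Theorems

namespace CampaignW46

namespace WWalk

variable {K : Type*} [Field K]

local notation "R3" => MvPowerSeries (Option (Fin 2)) K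
local notation "𝔪3" => IsLocalRing.maximalIdeal (MvPowerSeries (Option (Fin 2)) K)

/-! ## §3 (ND) from the two presentations -/

/-- Degree-one coefficients of `r · x` for `x(0) = 0`: `[e](r x) = r(0) · [e] x`. [folklore] -/
theorem coeff_degree_one_mul (r x : R3) (hx : constantCoeff x = 0) {e : Option (Fin 2) →₀ ℕ} (he : e.degree = 1) :
    coeff e (r * x) = constantCoeff r * coeff e x := by
  have hr : r - C (constantCoeff r) ∈ 𝔪3 := by
    rw [mem_maximalIdeal_iff_constantCoeff_eq_zero, map_sub, constantCoeff_C, sub_self]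
  have hxm : x ∈ 𝔪3 := by rwa [mem_maximalIdeal_iff_constantCoeff_eq_zero]
  have hmem : (r - C (constantCoeff r)) * x ∈ 𝔪3 ^ 2 := by rw [pow_two]; exact Ideal.mul_mem_mul hr hxm
  have h0 := coeff_eq_zero_of_mem_maximalIdeal_pow hmem (e := e) (by omega)
  rw [sub_mul, map_sub, sub_eq_zero, coeff_C_mul] at h0
  exact h0

/-- **(ND) FROM o1's BINARY PRESENTATION (LEMMA D).** See the module docstring. [cite: Hauser2010, §F (tangent cone and residual
form); the comparison itself is folklore] -/
theorem ndz_of_presentation {p : ℕ} [Fact p.Prime] [CharP K p] {f u x₂ y₂ z₂ : R3} {a : ℕ → R3} {d₂ : ℕ}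
    (hu : constantCoeff u ≠ 0) (hx : constantCoeff x₂ = 0) (hy : constantCoeff y₂ = 0) (hz : constantCoeff z₂ = 0)
    (hspanT : ∃ r s w : R3, (X (some 0) : R3) = r * x₂ + s * y₂ + w * z₂)
    (hspanY : ∃ r s w : R3, (X (some 1) : R3) = r * x₂ + s * y₂ + w * z₂)
    (hd₂ : p + 1 ≤ d₂) (hd₂' : d₂ + 1 ≤ 2 * p) (ha : ∃ i, i ≤ d₂ ∧ constantCoeff (a i) ≠ 0) (hf : LowVanish (p + 1) f)
    (hg : X none ^ p + f = u * (z₂ ^ p + ∑ i ∈ range (d₂ + 1), a i * x₂ ^ (d₂ - i) * y₂ ^ i)) :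
    (∀ a' b c, a' + b + c < d₂ → c < p → coeff (mk3 a' b c) f = 0) ∧ NDz d₂ f := by
  classical
  have hp2 : 2 ≤ p := (Fact.out : p.Prime).two_le
  set f₂ := ∑ i ∈ range (d₂ + 1), a i * x₂ ^ (d₂ - i) * y₂ ^ i with hf₂
  have hxm : x₂ ∈ 𝔪3 := by rwa [mem_maximalIdeal_iff_constantCoeff_eq_zero]
  have hym : y₂ ∈ 𝔪3 := by rwa [mem_maximalIdeal_iff_constantCoeff_eq_zero]
  -- `f₂ ∈ 𝔪^{d₂}`, `u f₂ ∈ 𝔪^{d₂}`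
  have hf₂mem : f₂ ∈ 𝔪3 ^ d₂ := by
    refine Ideal.sum_mem _ fun i hi => ?_
    rw [mem_range] at hi
    rw [mul_assoc]
    refine Ideal.mul_mem_left _ _ ?_
    have h := Ideal.mul_mem_mul (Ideal.pow_mem_pow hxm (d₂ - i)) (Ideal.pow_mem_pow hym i)
    rwa [← pow_add, show d₂ - i + i = d₂ by omega] at h
  have huf₂ : u * f₂ ∈ 𝔪3 ^ d₂ := Ideal.mul_mem_left _ _ hf₂mem
  -- the coefficient identity
  have hco : ∀ e, coeff e (X none ^ p : R3) + coeff e f = coeff e (u * z₂ ^ p) + coeff e (u * f₂) := by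
    intro e; have := congrArg (coeff e) hg; rw [mul_add] at this; simpa only [map_add] using this
  have hXp : ∀ a b cz, coeff (mk3 a b cz) (X none ^ p : R3) = if a = 0 ∧ b = 0 ∧ cz = p then 1 else 0 := by
    intro a b cz
    rw [X_pow_eq, coeff_monomial]
    have : mk3 a b cz = Finsupp.single none p ↔ (a = 0 ∧ b = 0 ∧ cz = p) := by
      rw [show Finsupp.single none p = mk3 0 0 p by simp [mk3], mk3_inj]
    by_cases h : a = 0 ∧ b = 0 ∧ cz = p
    · rw [if_pos (this.mpr h), if_pos h]
    · rw [if_neg (fun h' => h (this.mp h')), if_neg h]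
  set u₀ := constantCoeff u with hu₀
  have hu₀' : coeff (mk3 0 0 0) u = u₀ := by
    rw [show mk3 0 0 0 = (0 : Option (Fin 2) →₀ ℕ) by ext o; rcases o with _ | ⟨i, hi⟩ <;> simp [mk3], coeff_zero_eq_constantCoeff]
  -- Step A: the linear `t`- and `y`-coefficients of `z₂` vanish
  have hA : ∀ a b, a + b = p → coeff (mk3 a b 0) (u * z₂ ^ p) = 0 := by
    intro a b hab
    have h := hco (mk3 a b 0)
    rw [hXp, if_neg (by omega), hf _ (by rw [degree_mk3]; omega),
      coeff_eq_zero_of_mem_maximalIdeal_pow huf₂ (by rw [degree_mk3]; omega), zero_add, add_zero] at h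
    exact h.symm
  have hβz : coeff (mk3 1 0 0) z₂ = 0 := by
    have h := hA p 0 (by omega)
    rw [coeff_mul_pow_p u z₂ hz p 0 0 (by omega)] at h
    simp only [le_refl, if_true, Nat.sub_self, show ¬ p ≤ 0 by omega, if_false, add_zero, hu₀'] at h
    exact (pow_eq_zero_iff (by omega : p ≠ 0)).mp ((mul_eq_zero.mp h).resolve_left hu)
  have hγz : coeff (mk3 0 1 0) z₂ = 0 := by
    have h := hA 0 p (by omega)
    rw [coeff_mul_pow_p u z₂ hz 0 p 0 (by omega)] at h
    simp only [le_refl, if_true, Nat.sub_self, show ¬ p ≤ 0 by omega, if_false, add_zero, zero_add, hu₀'] at h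
    exact (pow_eq_zero_iff (by omega : p ≠ 0)).mp ((mul_eq_zero.mp h).resolve_left hu)
  -- Step B: `u z₂^p` has no monomial of degree `< 2p` with `z`-exponent `< p`
  have hB : ∀ a b c, a + b + c < 2 * p → c < p → coeff (mk3 a b c) (u * z₂ ^ p) = 0 := by
    intro a b c habc hc
    rw [coeff_mul_pow_p u z₂ hz a b c habc, hβz, hγz, zero_pow (by omega), mul_zero, mul_zero, if_neg (by omega : ¬ p ≤ c)]
    simp
  -- hence these coefficients of `f` are those of `u f₂`
  have hfeq : ∀ a b c, a + b + c < 2 * p → c < p → coeff (mk3 a b c) f = coeff (mk3 a b c) (u * f₂) := by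
    intro a b c habc hc
    have h := hco (mk3 a b c)
    rw [hXp, if_neg (by omega), hB a b c habc hc, zero_add, zero_add] at h
    exact h
  refine ⟨fun a b c habc hc => ?_, ?_⟩
  · rw [hfeq a b c (by omega) hc]
    exact coeff_eq_zero_of_mem_maximalIdeal_pow huf₂ (by rw [degree_mk3]; omega)
  -- Part 2: (ND)
  set βx := coeff (mk3 1 0 0) x₂ with hβx
  set γx := coeff (mk3 0 1 0) x₂ with hγx
  set αx := coeff (mk3 0 0 1) x₂ with hαx
  set βy := coeff (mk3 1 0 0) y₂ with hβy
  set γy := coeff (mk3 0 1 0) y₂ with hγy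
  set αy := coeff (mk3 0 0 1) y₂ with hαy
  have hLx : linPart x₂ = linTY βx γx + C αx * X none := rfl
  have hLy : linPart y₂ = linTY βy γy + C αy * X none := rfl
  set P := ∑ i ∈ range (d₂ + 1), C (constantCoeff (a i)) * (linPart x₂ ^ (d₂ - i) * linPart y₂ ^ i) with hP
  set Q := ∑ i ∈ range (d₂ + 1), C (constantCoeff (a i)) * (linTY βx γx ^ (d₂ - i) * linTY βy γy ^ i) with hQ
  have hLxm := linPart_mem x₂
  have hLym := linPart_mem y₂
  have hPmem : P ∈ 𝔪3 ^ d₂ := by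
    refine Ideal.sum_mem _ fun i hi => ?_
    rw [mem_range] at hi
    refine Ideal.mul_mem_left _ _ ?_
    have h := Ideal.mul_mem_mul (Ideal.pow_mem_pow hLxm (d₂ - i)) (Ideal.pow_mem_pow hLym i)
    rwa [← pow_add, show d₂ - i + i = d₂ by omega] at h
  -- (5d) `f₂ - P ∈ 𝔪^{d₂+1}`
  have hdiff : f₂ - P ∈ 𝔪3 ^ (d₂ + 1) := by
    rw [hf₂, hP, ← sum_sub_distrib]
    refine Ideal.sum_mem _ fun i hi => ?_
    rw [mem_range] at hi
    have h1 : x₂ ^ (d₂ - i) * y₂ ^ i - linPart x₂ ^ (d₂ - i) * linPart y₂ ^ i ∈ 𝔪3 ^ (d₂ + 1) := by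
      rw [show d₂ + 1 = (d₂ - i) + i + 1 by omega]
      exact mul_sub_mul_mem (pow_sub_pow_mem (sub_linPart_mem x₂ hx) hLxm _) (pow_sub_pow_mem (sub_linPart_mem y₂ hy) hLym _)
        (Ideal.pow_mem_pow hxm _) (Ideal.pow_mem_pow hLym _)
    have h2 : (a i - C (constantCoeff (a i))) * (linPart x₂ ^ (d₂ - i) * linPart y₂ ^ i) ∈ 𝔪3 ^ (d₂ + 1) := by
      rw [pow_succ']
      refine Ideal.mul_mem_mul ?_ ?_
      · rw [mem_maximalIdeal_iff_constantCoeff_eq_zero, map_sub, constantCoeff_C, sub_self]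
      · have h := Ideal.mul_mem_mul (Ideal.pow_mem_pow hLxm (d₂ - i)) (Ideal.pow_mem_pow hLym i)
        rwa [← pow_add, show d₂ - i + i = d₂ by omega] at h
    have : a i * x₂ ^ (d₂ - i) * y₂ ^ i - C (constantCoeff (a i)) * (linPart x₂ ^ (d₂ - i) * linPart y₂ ^ i) =
        a i * (x₂ ^ (d₂ - i) * y₂ ^ i - linPart x₂ ^ (d₂ - i) * linPart y₂ ^ i) +
          (a i - C (constantCoeff (a i))) * (linPart x₂ ^ (d₂ - i) * linPart y₂ ^ i) := by ring
    rw [this]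
    exact Ideal.add_mem _ (Ideal.mul_mem_left _ _ h1) h2
  -- (5e) `u f₂ - C u₀ * P ∈ 𝔪^{d₂+1}`
  have hdiff2 : u * f₂ - C u₀ * P ∈ 𝔪3 ^ (d₂ + 1) := by
    have : u * f₂ - C u₀ * P = u * (f₂ - P) + (u - C u₀) * P := by ring
    rw [this]
    refine Ideal.add_mem _ (Ideal.mul_mem_left _ _ hdiff) ?_
    rw [pow_succ']
    refine Ideal.mul_mem_mul ?_ hPmem
    rw [mem_maximalIdeal_iff_constantCoeff_eq_zero, map_sub, constantCoeff_C, hu₀, sub_self]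
  -- (5g) `P - Q` is a multiple of `z`
  have hPQ : (X none : R3) ∣ P - Q := by
    rw [hP, hQ, ← sum_sub_distrib]
    refine Finset.dvd_sum fun i _ => ?_
    rw [← mul_sub]
    refine Dvd.dvd.mul_left ?_ _
    have hx' : (X none : R3) ∣ linPart x₂ ^ (d₂ - i) - linTY βx γx ^ (d₂ - i) :=
      (Dvd.intro (C αx) (by rw [hLx]; ring)).trans (sub_dvd_pow_sub_pow _ _ _)
    have hy' : (X none : R3) ∣ linPart y₂ ^ i - linTY βy γy ^ i :=
      (Dvd.intro (C αy) (by rw [hLy]; ring)).trans (sub_dvd_pow_sub_pow _ _ _)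
    have : linPart x₂ ^ (d₂ - i) * linPart y₂ ^ i - linTY βx γx ^ (d₂ - i) * linTY βy γy ^ i =
        linPart x₂ ^ (d₂ - i) * (linPart y₂ ^ i - linTY βy γy ^ i) +
          (linPart x₂ ^ (d₂ - i) - linTY βx γx ^ (d₂ - i)) * linTY βy γy ^ i := by ring
    rw [this]
    exact dvd_add (hy'.mul_left _) (hx'.mul_right _)
  -- so the `z`-free degree-`d₂` coefficients of `f` are `u₀ ·` those of `Q`
  have hcoefQ : ∀ a' b, a' + b = d₂ → coeff (mk3 a' b 0) f = u₀ * coeff (mk3 a' b 0) Q := by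
    intro a' b hab
    rw [hfeq a' b 0 (by omega) (by omega)]
    have h1 := coeff_eq_zero_of_mem_maximalIdeal_pow hdiff2 (e := mk3 a' b 0) (by rw [degree_mk3]; omega)
    rw [map_sub, sub_eq_zero, coeff_C_mul] at h1
    rw [h1]
    obtain ⟨W, hW⟩ := hPQ
    have h2 : coeff (mk3 a' b 0) P - coeff (mk3 a' b 0) Q = 0 := by
      rw [← map_sub, hW]; exact coeff_zfree_of_X_mul W a' b
    rw [sub_eq_zero.mp h2]
  -- (6) the determinant of the `t,y`-parts of `lin x₂, lin y₂`
  have hdet : βx * γy - γx * βy ≠ 0 := by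
    obtain ⟨r, s, w, hT⟩ := hspanT
    obtain ⟨r', s', w', hY⟩ := hspanY
    have e1 : Finsupp.degree (mk3 1 0 0) = 1 := by rw [degree_mk3]
    have e2 : Finsupp.degree (mk3 0 1 0) = 1 := by rw [degree_mk3]
    have hs0 : Finsupp.single (some 0) 1 = mk3 1 0 0 := by simp [mk3]
    have hs1 : Finsupp.single (some 1) 1 = mk3 0 1 0 := by simp [mk3]
    have t1 := congrArg (coeff (mk3 1 0 0)) hT
    have t2 := congrArg (coeff (mk3 0 1 0)) hT
    have y1 := congrArg (coeff (mk3 1 0 0)) hY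
    have y2 := congrArg (coeff (mk3 0 1 0)) hY
    rw [map_add, map_add, coeff_degree_one_mul _ _ hx e1, coeff_degree_one_mul _ _ hy e1, coeff_degree_one_mul _ _ hz e1, hβz,
      mul_zero, add_zero, coeff_X, hs0, if_pos rfl] at t1
    rw [map_add, map_add, coeff_degree_one_mul _ _ hx e2, coeff_degree_one_mul _ _ hy e2, coeff_degree_one_mul _ _ hz e2, hγz,
      mul_zero, add_zero, coeff_X, hs0, if_neg (by rw [mk3_inj]; omega)] at t2
    rw [map_add, map_add, coeff_degree_one_mul _ _ hx e1, coeff_degree_one_mul _ _ hy e1, coeff_degree_one_mul _ _ hz e1, hβz,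
      mul_zero, add_zero, coeff_X, hs1, if_neg (by rw [mk3_inj]; omega)] at y1
    rw [map_add, map_add, coeff_degree_one_mul _ _ hx e2, coeff_degree_one_mul _ _ hy e2, coeff_degree_one_mul _ _ hz e2, hγz,
      mul_zero, add_zero, coeff_X, hs1, if_pos rfl] at y2
    intro hdet0
    have key : (constantCoeff r * constantCoeff s' - constantCoeff s * constantCoeff r') * (βx * γy - γx * βy) =
        (constantCoeff r * βx + constantCoeff s * βy) * (constantCoeff r' * γx + constantCoeff s' * γy) -
          (constantCoeff r * γx + constantCoeff s * γy) * (constantCoeff r' * βx + constantCoeff s' * βy) := by ring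
    rw [hdet0, mul_zero, ← t1, ← t2, ← y1, ← y2] at key
    norm_num at key
  -- (7) conclude
  obtain ⟨i₀, hi₀, hai₀⟩ := ha
  obtain ⟨a', b, hab, hne⟩ := exists_coeff_binaryForm_ne_zero hdet (fun i => constantCoeff (a i)) d₂ hi₀ hai₀
  exact ⟨a', b, hab, by rw [hcoefQ a' b hab]; exact mul_ne_zero hu hne⟩

end WWalk

end CampaignW46

end Summit.ResolutionOfSingularities.ResolutionOfSingularities.Theorems

end
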